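/-
Copyright (c) 2026 the pub-hodgecm-mathlib formalisation cell (harness21).  Prover seat hodgecm-mathlib-K2E2-p12 (g6): Track B «K2-LIT», ENGINE E1,
h413 = stmt-HodgeConjecture-24833; line `K2_E1_TraceFormulaBeta`, 5Res campaign «ENDGAME BY FAMILIES», letter (ii) `hPfix` of K2E4-p23's (254) census `K2E1ResidualPartInAtomsCMTwo`:
THE BLOCK PROJECTOR `P = P_χ ∘ R_f(e_{U₀})` FIXES EVERY `U₀`-INVARIANT `χ⁻¹`-EIGENVECTOR OF `K_∞`.
-/
import Summits.HodgeConjecture.HodgeConjecture.Theorems.K2E1HeckeAlgebraLettersCM   -- ★ p860403 (+ ★ p860372 `K2E1KTypeProjectorPureTensorU`, ★ p860333, ★ `IntegratedOperator`)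
import HarnessLib

/-!
# K2·E1 — `K2E1BlockProjectorFixesVectorsU`: THE BLOCK PROJECTOR `P = P_χ ∘ R_f(e)` FIXES THE `(χ, U₀)`-VECTORS — `(∀ u ∈ U₀, π(1,u) x = x) → (∀ k, π(κ k, 1) x = χ(k⁻¹) • x) → P x = x`
# (the letter `hPfix` of ★ p860390 `levelFinite_of_atoms` ∕ K2E4-p23's bridge (254) `K2E1ResidualPartInAtomsCMTwo`) [Knapp 1986 VIII §3; Borel–Jacquet §4.1; Deitmar–Echterhoff Lemma 1.6.3]

Track B ∕ K2-LIT, crux h413 = `stmt-HodgeConjecture-24833`, route of record `HCCMUnconditional`; cell `hodgecm-mathlib`, squad K2, ENGINE E1 (5Res campaign, M2 v2 endgame bridge «D5′ ⇒ hatoms»).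
THEOREMS ONLY (no `def`, no `instance`, no notation, no named-fact hypothesis, no `sorry`; default heartbeats); lane `--supports stmt-HodgeConjecture-24833 --as helper` (count-neutral).
CLOSES NO SOCKET.  The VECTOR-LEVEL companions of the operator identities of ★ p860372 (`integratedOperator_comp_eq_of_forall_apply_comp`, `integratedOperator_comp_eq_self_of_eigen`):
* §1 (any `σ` of `Γ`, `e ∈ C_c(Γ)` vanishing off `K′` with `∫ e dη = 1`): **`integratedOperator_apply_eq_self_of_forall_apply_eq`** — `σ(k) x = x` for `k ∈ K′` ⇒ `R(e) x = x` (E1: `R_f(e_{U₀}) x = x` for `U₀`-fixed `x`).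
* §2 (two-factor setting of ★ p860333∕p860372, `P_χ = ∫_K χ(k) π(ι₁ κ k) dμ`, `μ` probability, `χ` multiplicative with `χ 1 = 1`): **`kType_apply_eq_self_of_eigen`** — `π(ι₁ κ k) x = χ(k⁻¹) • x` for all `k` ⇒
  `P_χ x = x`; **`blockProjector_apply_eq_self`** — both hypotheses ⇒ `(P_χ ∘L R₂ e) x = x`.
* §3 E1 print at ★ `cmDatum L N H`: **`cm_blockProjector_hPfix`** — for `P = P_χ ∘L R_f(e)` (`κ : K →* U(H)(L⁺⊗ℝ)`, `e = e_{U₀}` supported in `U₀ ≤ U(H)(𝔸_f)` with `∫ e = 1`):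
  `(∀ u ∈ U₀, π (finAdelicToAdelic u) x = x) → (∀ k, π (archToAdelic (κ k)) x = χ k⁻¹ • x) → P x = x` — K2E4-p23's letter (ii) verbatim up to the name of `χ` (for a unitary character
  `χ(k⁻¹) = conj χ(k)`; with `χ = conj τ` the hypothesis reads `π(k) x = τ(k) x`, the `τ`-isotypic vectors).
HONEST LABEL: HC_CM is proved only modulo the 7 printed citations (2 remaining named inputs: hLiu418 = `stmt-HodgeConjecture-24832`, h413 = `stmt-HodgeConjecture-24833`) until rung 0
closes; this file asserts no named fact and closes no socket; count-neutral; unconditional.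

## References
* [Knapp1986] A. W. Knapp, *Representation Theory of Semisimple Groups* (1986): VIII §3 (`E_τ v = v` on the `τ`-isotypic subspace).
* [BorelJacquet1979] A. Borel, H. Jacquet, PSPM 33.1 (1979): §4.1 (`e_{K′}` acts as the identity on `K′`-fixed vectors).
* [DeitmarEchterhoff2014] A. Deitmar, S. Echterhoff, *Principles of Harmonic Analysis* (2014): Lemma 1.6.3, §7.4.
-/

set_option autoImplicit false
set_option linter.dupNamespace false -- the mandated namespace repeats `HodgeConjecture.HodgeConjecture`

noncomputable section

open MeasureTheory Filter Topology CompactlySupported NumberField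
open Literature.NumberTheory.Automorphic Literature.NumberTheory.Automorphic.UnitaryGroup AdelicGroupData
open Summit.HodgeConjecture.HodgeConjecture.Cruxes.H413.K2E1KTypeProjectorPureTensorU (chi_mul_chi_inv)

namespace Summit.HodgeConjecture.HodgeConjecture.Cruxes.H413.K2E1BlockProjectorFixesVectorsU

/-! ## §1 The level idempotent fixes `K′`-fixed vectors -/

section Level

variable {Γ V : Type*} [Group Γ] [TopologicalSpace Γ] [MeasurableSpace Γ] [BorelSpace Γ]
  [NormedAddCommGroup V] [InnerProductSpace ℂ V] [CompleteSpace V]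
  (σ : ContRepresentation ℂ Γ V) (hu : σ.IsUnitary) (hc : σ.IsStronglyContinuous) (η : Measure Γ) [IsFiniteMeasureOnCompacts η]

/-- **`R(e) x = x` FOR A `K′`-FIXED VECTOR `x`** when `e` vanishes off `K′` and `∫ e dη = 1` (`R(e) x = ∫ e(g) σ(g) x = ∫ e(g) • x = x`; E1: `e = vol(U₀)⁻¹ 1_{U₀}`).
[cite: BorelJacquet1979, §4.1] [cite: DeitmarEchterhoff2014, Lemma 1.6.3] -/
theorem integratedOperator_apply_eq_self_of_forall_apply_eq (K' : Subgroup Γ) (e : C_c(Γ, ℂ)) (he0 : ∀ g, g ∉ K' → e g = 0) (he1 : ∫ g, e g ∂η = 1)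
    (x : V) (hx : ∀ k ∈ K', σ k x = x) : σ.integratedOperator hu hc η e x = x := by
  rw [ContRepresentation.integratedOperator_apply]
  have h : (fun g => e g • σ g x) = fun g => e g • x := by
    funext g
    by_cases hg : g ∈ K'
    · rw [hx g hg]
    · rw [he0 g hg, zero_smul, zero_smul]
  rw [h, integral_smul_const, he1, one_smul]

end Level

/-! ## §2 The `K`-type projector and the block projector fix the `(χ, K′)`-vectors -/

section TwoFactor

variable {G G₁ G₂ K V : Type*} [Group G] [TopologicalSpace G] [Group G₁] [TopologicalSpace G₁]
  [Group G₂] [TopologicalSpace G₂] [MeasurableSpace G₂] [BorelSpace G₂]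
  [Group K] [TopologicalSpace K] [MeasurableSpace K] [BorelSpace K]
  [NormedAddCommGroup V] [InnerProductSpace ℂ V] [CompleteSpace V]
  (π : ContRepresentation ℂ G V) (hu : π.IsUnitary) (hc : π.IsStronglyContinuous)
  (ι₁ : G₁ →* G) (hι₁ : Continuous ι₁) (ι₂ : G₂ →* G) (hι₂ : Continuous ι₂) (κ : K →* G₁) (hκ : Continuous κ)
  (η₂ : Measure G₂) [IsFiniteMeasureOnCompacts η₂] (μ : Measure K) [IsFiniteMeasureOnCompacts μ] [IsProbabilityMeasure μ] (χ : C_c(K, ℂ))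

omit [MeasurableSpace G₂] [BorelSpace G₂] [IsFiniteMeasureOnCompacts η₂] in
/-- **`P_χ x = x` FOR A `χ⁻¹`-EIGENVECTOR**: if `π(ι₁ κ k) x = χ(k⁻¹) • x` for all `k` then `P_χ x = ∫_K χ(k) χ(k⁻¹) • x dμ = x` (`μ` probability, `χ` multiplicative, `χ 1 = 1`; E1: `χ = conj τ`,
`x` `τ`-isotypic). [cite: Knapp1986, VIII §3] [cite: DeitmarEchterhoff2014, §7.4] -/
theorem kType_apply_eq_self_of_eigen (hχmul : ∀ k l, χ (k * l) = χ k * χ l) (hχone : χ 1 = 1) (x : V) (hx : ∀ k : K, π (ι₁ (κ k)) x = χ k⁻¹ • x) :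
    (π.restrict (ι₁.comp κ)).integratedOperator (hu.restrict (ι₁.comp κ)) (hc.restrict (ι₁.comp κ) (hι₁.comp hκ)) μ χ x = x := by
  rw [ContRepresentation.integratedOperator_apply]
  have h : (fun k => χ k • (π.restrict (ι₁.comp κ)) k x) = fun _ => x := by
    funext k
    rw [ContRepresentation.restrict_apply, MonoidHom.comp_apply, hx k, smul_smul, chi_mul_chi_inv χ hχmul hχone, one_smul]
  rw [h, integral_const, probReal_univ, one_smul]

/-- **THE BLOCK PROJECTOR FIXES THE `(χ, K′)`-VECTORS**: `x` `K′`-fixed under `π(ι₂ ·)` and a `χ⁻¹`-eigenvector under `π(ι₁ κ ·)` ⇒ `(P_χ ∘L R₂ e) x = x` (`e` vanishing off `K′`, `∫ e = 1`).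
[cite: Knapp1986, VIII §3] [cite: BorelJacquet1979, §4.1] -/
theorem blockProjector_apply_eq_self (hχmul : ∀ k l, χ (k * l) = χ k * χ l) (hχone : χ 1 = 1)
    (K' : Subgroup G₂) (e : C_c(G₂, ℂ)) (he0 : ∀ g, g ∉ K' → e g = 0) (he1 : ∫ g, e g ∂η₂ = 1)
    (x : V) (hxU : ∀ u ∈ K', π (ι₂ u) x = x) (hxχ : ∀ k : K, π (ι₁ (κ k)) x = χ k⁻¹ • x) :
    ((π.restrict (ι₁.comp κ)).integratedOperator (hu.restrict (ι₁.comp κ)) (hc.restrict (ι₁.comp κ) (hι₁.comp hκ)) μ χ ∘L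
        (π.restrict ι₂).integratedOperator (hu.restrict ι₂) (hc.restrict ι₂ hι₂) η₂ e) x = x := by
  rw [ContinuousLinearMap.comp_apply,
    integratedOperator_apply_eq_self_of_forall_apply_eq (π.restrict ι₂) (hu.restrict ι₂) (hc.restrict ι₂ hι₂) η₂ K' e he0 he1 x (fun u hu' => by rw [ContRepresentation.restrict_apply]; exact hxU u hu'),
    kType_apply_eq_self_of_eigen π hu hc ι₁ hι₁ κ hκ μ χ hχmul hχone x hxχ]

end TwoFactor

/-! ## §3 The E1 print at ★ `cmDatum L N H` — the letter `hPfix` -/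

section CM

variable {L : Type} [Field L] [NumberField L] [IsCMField L] {N : ℕ} {H : Matrix (Fin N) (Fin N) L}
  {K V : Type*} [Group K] [TopologicalSpace K] [MeasurableSpace K] [BorelSpace K]
  [NormedAddCommGroup V] [InnerProductSpace ℂ V] [CompleteSpace V]
  (π : ContRepresentation ℂ (cmDatum L N H).Adelic V) (hu : π.IsUnitary) (hc : π.IsStronglyContinuous)
  [MeasurableSpace (finAdelic (↥(maximalRealSubfield L)) L (IsCMField.complexConj L) N H)] [BorelSpace (finAdelic (↥(maximalRealSubfield L)) L (IsCMField.complexConj L) N H)]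
  (νf : Measure (finAdelic (↥(maximalRealSubfield L)) L (IsCMField.complexConj L) N H)) [IsFiniteMeasureOnCompacts νf]
  (κ : K →* UnitaryGroup.arch (↥(maximalRealSubfield L)) L (IsCMField.complexConj L) N H) (hκ : Continuous κ)
  (μ : Measure K) [IsFiniteMeasureOnCompacts μ] [IsProbabilityMeasure μ] (χ : C_c(K, ℂ)) (e : C_c(finAdelic (↥(maximalRealSubfield L)) L (IsCMField.complexConj L) N H, ℂ))

/-- **`hPfix` AT `U(H)(𝔸_{L⁺})`**: the block projector `P = P_χ ∘L R_f(e)` fixes every vector that is `U₀`-invariant under the finite-adelic factor and a `χ⁻¹`-eigenvector of the compact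
`κ(K) ≤ U(H)(L⁺ ⊗ ℝ)` — K2E4-p23's letter (ii) of the bridge «D5′ ⇒ `hatoms`» (★ p860390 `levelFinite_of_atoms`). [cite: Knapp1986, VIII §3] [cite: BorelJacquet1979, §4.1] -/
theorem cm_blockProjector_hPfix (hχmul : ∀ k l, χ (k * l) = χ k * χ l) (hχone : χ 1 = 1)
    (U₀ : Subgroup (finAdelic (↥(maximalRealSubfield L)) L (IsCMField.complexConj L) N H)) (he0 : ∀ g, g ∉ U₀ → e g = 0) (he1 : ∫ g, e g ∂νf = 1)
    (x : V) (hxU : ∀ u ∈ U₀, π (finAdelicToAdelic (↥(maximalRealSubfield L)) L (IsCMField.complexConj L) N H u) x = x)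
    (hxχ : ∀ k : K, π (archToAdelic (↥(maximalRealSubfield L)) L (IsCMField.complexConj L) N H (κ k)) x = χ k⁻¹ • x) :
    ((π.restrict ((archToAdelic (↥(maximalRealSubfield L)) L (IsCMField.complexConj L) N H).comp κ)).integratedOperator (hu.restrict _)
          (hc.restrict _ ((continuous_archToAdelic (↥(maximalRealSubfield L)) L (IsCMField.complexConj L) N H).comp hκ)) μ χ ∘L
        (π.restrict (finAdelicToAdelic (↥(maximalRealSubfield L)) L (IsCMField.complexConj L) N H)).integratedOperator (hu.restrict _)
          (hc.restrict _ (continuous_finAdelicToAdelic (↥(maximalRealSubfield L)) L (IsCMField.complexConj L) N H)) νf e) x = x :=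
  blockProjector_apply_eq_self π hu hc _ (continuous_archToAdelic (↥(maximalRealSubfield L)) L (IsCMField.complexConj L) N H)
    _ (continuous_finAdelicToAdelic (↥(maximalRealSubfield L)) L (IsCMField.complexConj L) N H) κ hκ νf μ χ hχmul hχone U₀ e he0 he1 x hxU hxχ

end CM

end Summit.HodgeConjecture.HodgeConjecture.Cruxes.H413.K2E1BlockProjectorFixesVectorsU

end
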